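import Summits.CriticalPhenomena.PercolationContinuityZ3.Theorems.PercNearOneGluingNoHeavyLowerTailSahiCoordinateTwoThirds
import Literature.Combinatorics.Sahi2008.Percolation
import Summits.CriticalPhenomena.PercolationContinuityZ3.Theorems.PercNearOneGluingNoHeavyLowerTailSunflowerCloneGamma
import Summits.CriticalPhenomena.PercolationContinuityZ3.Theorems.PercNearOneGluingNoHeavyQuantLevelTrials
import Literature.Probability.LatticeModels.SahiE3Reflection
import Mathlib.Tactic.Linarith
import Mathlib.Tactic.Ring
import HarnessLib

/-!
# `NoHeavyLowerTail` (crux stmt-CriticalPhenomena-4575), master-family line P1 (abstract tower): the WEAK two-level law on the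
# CO-SUNFLOWER class `(G₂ ∪ G₃, G₁ ∪ G₃, G₁ ∪ G₂)` — typed, with its reduction to Sahi's `C_3` on that class
# (= Kahn's Conjecture 5 on the complements of a three-petal sunflower, the tree's open instance `(1 + a)(ab − e₂) ≥ e₃`)

Support file (seat `prim-masterthm-p1`, gen 7; `--supports stmt-CriticalPhenomena-4575`); ONE `@[conjecture]` definition
(`CoSunflowerTwoLevel`, an obligation of THIS programme — census-clean, NOT a published fact), no sorry.
Memo `run/shared/lean/prim/prim-masterthm/FROM-prim-masterthm-p1-g7-CLASS-TANGENT.md`.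

SETTING (P2's cube vocabulary, `…SahiCoordinateTwoThirds`).  For an increasing triple `U = ![A, B, C]` on the finite cube `Set ι`, a product
weight `μ_p` and a coordinate `e`, `B₀, B₁, B₂, B₃` are the degree-3 Bernstein coefficients of `s ↦ E_3(μ_{p[e↦s]}; 1_U)`
(`B₀ = E_3(U^{e←0})`, `B₃ = E_3(U^{e←1})`), `b₁ = coordPiece₁ = 3B₁ − 2B₀ − B₃`, `b₂ = coordPiece₂ = 3B₂ − B₀ − 2B₃`, and
`E_3 = (1−t)B₀ + tB₃ + t(1−t)[(1−t)b₁ + tb₂]` (`sahiE_three_decomp_coord`, `t = p_e`), `b₂ ≤ b₁` for increasing events.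

* `sahiE_three_nonneg_of_weakTwoLevelAt` — **THE WEAK LOCAL STEP** (every increasing triple, no class hypothesis): the single inequality
  `3B₂(e) ≥ B₃(e)` (⟺ `b₂ + B₀ + B₃ ≥ 0`, bnk-2's TOP two-level law `SahiTwoLevelPlus` AT THE ONE pair of sections along `e`) together with
  `E_3 ≥ 0` for the two `e`-sections gives `E_3 ≥ (1−t)²·B₀ + t²·B₃ ≥ 0`.  (P2's local step `sahiE_three_nonneg_of_twoThirdsAt` needs the
  stronger — and refuted — `3B₂ ≥ 2B₃`; bnk-2's `masterFamilyNonneg_three_of_sahiTwoLevelPlus` needs the law for ALL nested pairs.  Here one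
  coordinate of the given triple suffices, with no substitution: the bound `(1−t)b₁ + tb₂ ≥ b₂ ≥ −(B₀ + B₃)`.)
* `CoSunflowerTwoLevel` — **CONJECTURE (class two-level law)**: `3B₂(e) ≥ B₃(e)` at every coordinate of every triple of the form
  `(G₂ ∪ G₃, G₁ ∪ G₃, G₁ ∪ G₂)`, `G₁, G₂, G₃` ARBITRARY increasing events (equivalently: of every increasing triple whose three pairwise
  UNIONS coincide).  CENSUS (this seat, exact, comb level ⇒ every product weight): the STRONGER law `3B₂ ≥ 2B₃` holds at every axis and every
  tensor-Bernstein fibre of ALL 3 949 823 such triples on `≤ 5` coordinates (kit j148116; `2B₁ ≥ B₂`, `B₁ ≥ B₀` and comb positivity of `E_3`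
  likewise), whereas for general increasing triples `3B₂ ≥ 2B₃` fails on 5 coordinates (`…SahiCoordinateTwoThirdsFalse`); `3B₂ ≥ B₃` for ALL
  increasing triples is P2/bnk-2's census-clean λ = 2 rung (`SahiTwoLevelPlus`, exhaustive `k ≤ 5`).  Random structured samples on 6 and 7
  coordinates: see the memo.
* `sahiE_three_pairUnion_nonneg_of_coSunflowerTwoLevel` — **REDUCTION**: `CoSunflowerTwoLevel → E_3(μ_p; G₂∪G₃, G₁∪G₃, G₁∪G₂) ≥ 0` for all
  increasing `G_i` on every finite cube (induction on a determining set: the class is closed under sections, `secAt_union`, `Quant.determinedBy_union_of`);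
  `sahiE_three_nonneg_of_pairwise_union_eq` — the same for every increasing triple with equal pairwise unions;
  `sahiE3_compl_sunflower_nonneg_of_coSunflowerTwoLevel` — hence, by the reflection `ω ↦ ωᶜ, p ↦ 1 − p`
  (`sahiE3_eq_sahiE3_preimage_compl`), **`E_3(μ_p; U₁ᶜ, U₂ᶜ, U₃ᶜ) ≥ 0` for every three-petal SUNFLOWER of increasing events**
  (`U_i ∩ U_j = A` for `i ≠ j`), i.e. the tree's recognised-open `(1 + a)(ab − e₂) ≥ e₃` (`Literature/…/SahiSunflowerSeparation.lean`: the
  three-point pairwise-separation row 3PT-LB, the four-point perfect-matching row, gen-5's tow3) — CONDITIONAL on `CoSunflowerTwoLevel`.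
HONEST FRAMING: a typed conjecture and its consequences; `CoSunflowerTwoLevel`, AT_3 = `(1+a)(ab−e₂) ≥ e₃` beyond 5 coordinates and Kahn's
Conjecture 5 remain OPEN.  The seat's aggregate analysis (memo §3) shows the class law does NOT follow from AT_3 at the two levels plus every
Harris inequality among the cells — a proof needs the up-set structure.  Axioms standard. [this work]
-/

noncomputable section

open scoped Classical

namespace Summit.CriticalPhenomena.PercolationContinuityZ3.Theorems

namespace SahiCoSunflowerTwoLevel

open Finset Function
open Literature.Combinatorics.Sahi2008
open Literature.Probability.LatticeModels (sahiE3 prodBernoulli)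
open Literature.Probability.Percolation (DeterminedBy determinedBy_iff)
open Literature.Probability.Percolation.DecisionTree (ind ind_of_mem ind_of_not_mem ind_nonneg)
open SahiCoordinateBernstein (coordPiece₁ coordPiece₂ sahiE_three_decomp_coord)
open SahiCoordinateTwoThirds (coordPiece₂_le_coordPiece₁ ind_secAt_vec3)

variable {ι : Type} [Fintype ι]

/-! ### 1. The weak local step (general increasing triples) -/

/-- **WEAK LOCAL STEP.**  For an increasing triple `(A,B,C)` and a coordinate `e`: the two-level TOP law AT `e`,
`b₂(e) + B₀(e) + B₃(e) ≥ 0` (i.e. `3B₂ ≥ B₃`), together with `E_3 ≥ 0` for the two `e`-sections, gives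
`E_3(μ_p; A, B, C) ≥ (1−t)²·E_3(A⁰,B⁰,C⁰) + t²·E_3(A¹,B¹,C¹) ≥ 0` (`t = p_e`), because `(1−t)b₁ + tb₂ ≥ b₂` (`b₂ ≤ b₁` for increasing
events). [this work] -/
theorem sahiE_three_nonneg_of_weakTwoLevelAt (p : ι → unitInterval) (e : ι) {A B C : Set (Set ι)} (hA : IsUpperSet A)
    (hB : IsUpperSet B) (hC : IsUpperSet C)
    (hW : 0 ≤ coordPiece₂ p e ![A, B, C]
        + sahiE (bernoulliWeight p) 3 ![ind (secAt e false A), ind (secAt e false B), ind (secAt e false C)]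
        + sahiE (bernoulliWeight p) 3 ![ind (secAt e true A), ind (secAt e true B), ind (secAt e true C)])
    (h0 : 0 ≤ sahiE (bernoulliWeight p) 3 ![ind (secAt e false A), ind (secAt e false B), ind (secAt e false C)])
    (h1 : 0 ≤ sahiE (bernoulliWeight p) 3 ![ind (secAt e true A), ind (secAt e true B), ind (secAt e true C)]) :
    0 ≤ sahiE (bernoulliWeight p) 3 ![ind A, ind B, ind C] := by
  have hdec := sahiE_three_decomp_coord p e ![A, B, C]
  rw [Pointwise.ind_vec3, ind_secAt_vec3, ind_secAt_vec3] at hdec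
  have h12 := coordPiece₂_le_coordPiece₁ p e hA hB hC
  have ht0 : 0 ≤ (p e : ℝ) := (p e).2.1
  have ht1' : (p e : ℝ) ≤ 1 := (p e).2.2
  have ht1 : 0 ≤ 1 - (p e : ℝ) := by linarith
  -- the mixed piece is at least `−(B₀ + B₃)`
  have hmix : -(sahiE (bernoulliWeight p) 3 ![ind (secAt e false A), ind (secAt e false B), ind (secAt e false C)]
        + sahiE (bernoulliWeight p) 3 ![ind (secAt e true A), ind (secAt e true B), ind (secAt e true C)]) ≤
      (1 - (p e : ℝ)) * coordPiece₁ p e ![A, B, C] + (p e : ℝ) * coordPiece₂ p e ![A, B, C] := by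
    nlinarith [mul_nonneg ht1 (sub_nonneg.2 h12)]
  rw [hdec]
  have hpq : 0 ≤ (p e : ℝ) * (1 - (p e : ℝ)) := mul_nonneg ht0 ht1
  nlinarith [mul_le_mul_of_nonneg_left hmix hpq, mul_nonneg (pow_nonneg ht1 2) h0, mul_nonneg (pow_nonneg ht0 2) h1]

/-! ### 2. The class law, typed -/

/-- **CONJECTURE (two-level law on the co-sunflower class)**, an obligation of this programme (NOT a published fact): for every finite cube,
every product weight `p`, every three increasing events `G₁, G₂, G₃` and EVERY coordinate `e`, the increasing triple
`U = (G₂ ∪ G₃, G₁ ∪ G₃, G₁ ∪ G₂)` satisfies `3B₂(e) ≥ B₃(e)`, i.e. `coordPiece₂ p e U + E_3(U^{e←0}) + E_3(U^{e←1}) ≥ 0`.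
Census (this seat, kit j148116, exact): the stronger `3B₂ ≥ 2B₃` holds at the comb level for all 3 949 823 such triples on `≤ 5` coordinates;
for all increasing triples `3B₂ ≥ B₃` is the census-clean λ = 2 rung of P2/bnk-2 (`SahiTwoLevelPlus`).  Implies Sahi's `C_3` on the class
(`sahiE_three_pairUnion_nonneg_of_coSunflowerTwoLevel`), hence `(1 + a)(ab − e₂) ≥ e₃` on sunflower complements.
[cite: Kahn2022, Conj. 5 (arXiv p. 3); Gladkov2024StrongFKG, Thm. 2.1] [status: open] -/
@[conjecture] def CoSunflowerTwoLevel : Prop :=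
  ∀ (ι : Type) [Fintype ι] (p : ι → unitInterval) (G₁ G₂ G₃ : Set (Set ι)), IsUpperSet G₁ → IsUpperSet G₂ → IsUpperSet G₃ →
    ∀ e : ι, 0 ≤ coordPiece₂ p e ![G₂ ∪ G₃, G₁ ∪ G₃, G₁ ∪ G₂]
      + sahiE (bernoulliWeight p) 3
          ![ind (secAt e false (G₂ ∪ G₃)), ind (secAt e false (G₁ ∪ G₃)), ind (secAt e false (G₁ ∪ G₂))]
      + sahiE (bernoulliWeight p) 3
          ![ind (secAt e true (G₂ ∪ G₃)), ind (secAt e true (G₁ ∪ G₃)), ind (secAt e true (G₁ ∪ G₂))]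

/-! ### 3. The reduction: class law ⟹ `C_3` on the class -/

/-- **`C_3` ON THE CO-SUNFLOWER CLASS from the class two-level law** (induction on the size of a determining set; the sections of
`(G₂∪G₃, G₁∪G₃, G₁∪G₂)` are the same expressions in the sections of the `G_i`, which are increasing and determined by one coordinate fewer).
[this work] -/
theorem sahiE_three_pairUnion_nonneg_of_coSunflowerTwoLevel (h : CoSunflowerTwoLevel) {κ : Type} [Fintype κ]
    (p : κ → unitInterval) {G₁ G₂ G₃ : Set (Set κ)} (h₁ : IsUpperSet G₁) (h₂ : IsUpperSet G₂) (h₃ : IsUpperSet G₃) :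
    0 ≤ sahiE (bernoulliWeight p) 3 ![ind (G₂ ∪ G₃), ind (G₁ ∪ G₃), ind (G₁ ∪ G₂)] := by
  suffices key : ∀ (m : ℕ) (X Y Z : Set (Set κ)) (S : Finset κ), S.card = m → IsUpperSet X → IsUpperSet Y → IsUpperSet Z →
      DeterminedBy X (↑S : Set κ) → DeterminedBy Y (↑S : Set κ) → DeterminedBy Z (↑S : Set κ) →
      0 ≤ sahiE (bernoulliWeight p) 3 ![ind (Y ∪ Z), ind (X ∪ Z), ind (X ∪ Y)] from
    key _ G₁ G₂ G₃ Finset.univ rfl h₁ h₂ h₃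
      ((determinedBy_iff _ _).2 fun ω ω' hω => by
        rw [Finset.coe_univ, Set.inter_univ, Set.inter_univ] at hω; rw [hω])
      ((determinedBy_iff _ _).2 fun ω ω' hω => by
        rw [Finset.coe_univ, Set.inter_univ, Set.inter_univ] at hω; rw [hω])
      ((determinedBy_iff _ _).2 fun ω ω' hω => by
        rw [Finset.coe_univ, Set.inter_univ, Set.inter_univ] at hω; rw [hω])
  intro m
  induction m using Nat.strong_induction_on with
  | _ m ih =>
  intro X Y Z S hS hX hY hZ hXS hYS hZS
  rcases S.eq_empty_or_nonempty with hSe | hSne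
  · subst hSe
    have hV : ∀ j, DeterminedBy ((![Y ∪ Z, X ∪ Z, X ∪ Y] : Fin 3 → Set (Set κ)) j) ((∅ : Finset κ) : Set κ) := by
      intro j
      fin_cases j
      · exact Quant.determinedBy_union_of hYS hZS
      · exact Quant.determinedBy_union_of hXS hZS
      · exact Quant.determinedBy_union_of hXS hYS
    have h0 := masterFamilyEqIff_mpr 3 κ p ![Y ∪ Z, X ∪ Z, X ∪ Y] (Pointwise.suppZeroFlag_three_of_determinedBy_empty _ hV)
    rw [Pointwise.ind_vec3] at h0
    exact h0.ge
  · obtain ⟨e, heS⟩ := hSne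
    have hlt : (S.erase e).card < m := by rw [← hS]; exact Finset.card_erase_lt_of_mem heS
    have E0 := ih _ hlt (secAt e false X) (secAt e false Y) (secAt e false Z) (S.erase e) rfl
      (isUpperSet_secAt e false hX) (isUpperSet_secAt e false hY) (isUpperSet_secAt e false hZ)
      (determinedBy_secAt e false hXS) (determinedBy_secAt e false hYS) (determinedBy_secAt e false hZS)
    have E1 := ih _ hlt (secAt e true X) (secAt e true Y) (secAt e true Z) (S.erase e) rfl
      (isUpperSet_secAt e true hX) (isUpperSet_secAt e true hY) (isUpperSet_secAt e true hZ)
      (determinedBy_secAt e true hXS) (determinedBy_secAt e true hYS) (determinedBy_secAt e true hZS)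
    rw [← SahiCombDisjunct.secAt_union, ← SahiCombDisjunct.secAt_union, ← SahiCombDisjunct.secAt_union] at E0 E1
    exact sahiE_three_nonneg_of_weakTwoLevelAt p e (hY.union hZ) (hX.union hZ) (hX.union hY)
      (by linarith [h κ p X Y Z hX hY hZ e, E0, E1]) E0 E1

/-- **`C_3` for increasing triples with equal pairwise unions** (the same class: `U_i = G_j ∪ G_k` with `G_i := U_j ∩ U_k`), conditional on
`CoSunflowerTwoLevel`. [this work] -/
theorem sahiE_three_nonneg_of_pairwise_union_eq (h : CoSunflowerTwoLevel) {κ : Type} [Fintype κ] (p : κ → unitInterval)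
    {U₁ U₂ U₃ : Set (Set κ)} (h₁ : IsUpperSet U₁) (h₂ : IsUpperSet U₂) (h₃ : IsUpperSet U₃) (h12 : U₁ ∪ U₂ = U₁ ∪ U₃)
    (h13 : U₁ ∪ U₂ = U₂ ∪ U₃) :
    0 ≤ sahiE (bernoulliWeight p) 3 ![ind U₁, ind U₂, ind U₃] := by
  have eU₁ : U₁ ∩ U₃ ∪ U₁ ∩ U₂ = U₁ := by
    ext ω; constructor
    · rintro (⟨hω, -⟩ | ⟨hω, -⟩) <;> exact hω
    · intro hω
      have : ω ∈ U₂ ∪ U₃ := by rw [← h13]; exact Or.inl hω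
      rcases this with h' | h'
      · exact Or.inr ⟨hω, h'⟩
      · exact Or.inl ⟨hω, h'⟩
  have eU₂ : U₂ ∩ U₃ ∪ U₁ ∩ U₂ = U₂ := by
    ext ω; constructor
    · rintro (⟨hω, -⟩ | ⟨-, hω⟩) <;> exact hω
    · intro hω
      have : ω ∈ U₁ ∪ U₃ := by rw [← h12]; exact Or.inr hω
      rcases this with h' | h'
      · exact Or.inr ⟨h', hω⟩
      · exact Or.inl ⟨hω, h'⟩
  have eU₃ : U₂ ∩ U₃ ∪ U₁ ∩ U₃ = U₃ := by
    ext ω; constructor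
    · rintro (⟨-, hω⟩ | ⟨-, hω⟩) <;> exact hω
    · intro hω
      have : ω ∈ U₁ ∪ U₂ := by rw [h13]; exact Or.inr hω
      rcases this with h' | h'
      · exact Or.inr ⟨h', hω⟩
      · exact Or.inl ⟨h', hω⟩
  have key := sahiE_three_pairUnion_nonneg_of_coSunflowerTwoLevel h p (h₂.inter h₃) (h₁.inter h₃) (h₁.inter h₂)
  rw [eU₁, eU₂, eU₃] at key
  exact key

/-! ### 4. Sunflower complements (both monotonicities) and the percolation row `γ` -/

/-- **Decreasing sunflower** (this is the form the percolation rows come in): for DOWN-sets `D₁, D₂, D₃` with all pairwise intersections equal to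
`K`, the complements `D_iᶜ` are increasing with equal pairwise unions, so `CoSunflowerTwoLevel` gives `0 ≤ E_3(μ_p; D₁ᶜ, D₂ᶜ, D₃ᶜ)`. [this work] -/
theorem sahiE3_compl_lowerSunflower_nonneg_of_coSunflowerTwoLevel (h : CoSunflowerTwoLevel) {κ : Type} [Fintype κ]
    (p : κ → unitInterval) {K D₁ D₂ D₃ : Set (Set κ)} (h₁ : IsLowerSet D₁) (h₂ : IsLowerSet D₂) (h₃ : IsLowerSet D₃)
    (h12 : D₁ ∩ D₂ = K) (h13 : D₁ ∩ D₃ = K) (h23 : D₂ ∩ D₃ = K) :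
    0 ≤ sahiE3 (prodBernoulli p) D₁ᶜ D₂ᶜ D₃ᶜ := by
  rw [← sahiE_three_ind]
  refine sahiE_three_nonneg_of_pairwise_union_eq h p h₁.compl h₂.compl h₃.compl ?_ ?_
  · rw [← Set.compl_inter, ← Set.compl_inter, h12, h13]
  · rw [← Set.compl_inter, ← Set.compl_inter, h12, h23]

/-- **Increasing sunflower** — the tree's recognised-open instance `(1 + a)(ab − e₂) ≥ e₃` (`Literature/…/SahiSunflowerSeparation.lean`,
`sahiE3_compl_sunflower_eq`): for increasing `U₁, U₂, U₃` with all pairwise intersections `A`, `CoSunflowerTwoLevel` gives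
`0 ≤ E_3(μ_p; U₁ᶜ, U₂ᶜ, U₃ᶜ)` (reflection `ω ↦ ωᶜ`, `p ↦ 1 − p`, then the decreasing form). [this work] -/
theorem sahiE3_compl_sunflower_nonneg_of_coSunflowerTwoLevel (h : CoSunflowerTwoLevel) {κ : Type} [Fintype κ]
    (p : κ → unitInterval) {A U₁ U₂ U₃ : Set (Set κ)} (h₁ : IsUpperSet U₁) (h₂ : IsUpperSet U₂) (h₃ : IsUpperSet U₃)
    (h12 : U₁ ∩ U₂ = A) (h13 : U₁ ∩ U₃ = A) (h23 : U₂ ∩ U₃ = A) :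
    0 ≤ sahiE3 (prodBernoulli p) U₁ᶜ U₂ᶜ U₃ᶜ := by
  rw [Literature.Probability.LatticeModels.sahiE3_eq_sahiE3_preimage_compl p MeasurableSet.of_discrete MeasurableSet.of_discrete
    MeasurableSet.of_discrete, Set.preimage_compl, Set.preimage_compl, Set.preimage_compl]
  exact sahiE3_compl_lowerSunflower_nonneg_of_coSunflowerTwoLevel h _
    (Literature.Probability.LatticeModels.isLowerSet_preimage_compl h₁)
    (Literature.Probability.LatticeModels.isLowerSet_preimage_compl h₂)
    (Literature.Probability.LatticeModels.isLowerSet_preimage_compl h₃)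
    (by rw [← Set.preimage_inter, h12]) (by rw [← Set.preimage_inter, h13]) (by rw [← Set.preimage_inter, h23])

/-- **`CoSunflowerTwoLevel ⇒ γ`**: the last open four-point E3GRP class `γ = E₃(lnk[ab|cy], lnk[ac|by], lnk[ay|bc]) ≥ 0` on every finite
weighted graph (`GammaRow`; the three group separations form a decreasing sunflower — `SunflowerPartition.groupSep_matchings_inter`), hence the
five-terminal rows `r4`, `r6` (`CoSunflowerGlue.rowHolds_four/six_of_gammaRow`).  Compare `SunflowerPartition.gammaRow_of_partitionLemmaH`
(prim-l12-p2 / prim-ineq-prove-1: the counting route). [this work] -/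
theorem gammaRow_of_coSunflowerTwoLevel (h : CoSunflowerTwoLevel) : GammaRow := by
  intro V _ w a b c y
  classical
  obtain ⟨e13, e23⟩ := SunflowerPartition.groupSep_matchings_inter a b c y
  rw [SunflowerPartition.groupConn_eq_compl_groupSep, SunflowerPartition.groupConn_eq_compl_groupSep,
    SunflowerPartition.groupConn_eq_compl_groupSep]
  exact sahiE3_compl_lowerSunflower_nonneg_of_coSunflowerTwoLevel h w
    (Literature.Combinatorics.Sahi2008.isLowerSet_groupSep _ _) (Literature.Combinatorics.Sahi2008.isLowerSet_groupSep _ _)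
    (Literature.Combinatorics.Sahi2008.isLowerSet_groupSep _ _) rfl e13.symm (e23.trans e13.symm)

/-- `CoSunflowerTwoLevel ⇒ r4` (five-terminal E3GRP row `RowHolds 4`). [this work] -/
theorem rowHolds_four_of_coSunflowerTwoLevel (h : CoSunflowerTwoLevel) {n : ℕ} (w : Sym2 (Fin n) → unitInterval)
    (t : E3GroupSepCert.Tup n) : E3GroupSepCert.RowHolds 4 w t :=
  CoSunflowerGlue.rowHolds_four_of_gammaRow (gammaRow_of_coSunflowerTwoLevel h) w t

/-- `CoSunflowerTwoLevel ⇒ r6` (five-terminal E3GRP row `RowHolds 6`). [this work] -/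
theorem rowHolds_six_of_coSunflowerTwoLevel (h : CoSunflowerTwoLevel) {n : ℕ} (w : Sym2 (Fin n) → unitInterval)
    (t : E3GroupSepCert.Tup n) : E3GroupSepCert.RowHolds 6 w t :=
  CoSunflowerGlue.rowHolds_six_of_gammaRow (gammaRow_of_coSunflowerTwoLevel h) w t

end SahiCoSunflowerTwoLevel

end Summit.CriticalPhenomena.PercolationContinuityZ3.Theorems
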